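/-
Copyright (c) 2026. All rights reserved.
Released under Apache 2.0 license as described in the file LICENSE.
-/
import Literature.NumberTheory.ComplexMultiplication.DegenerateCMTypesAbelianPrimePowerKernels
import HarnessLib

/-!
# Primitive DEGENERATE CM types on every abelian group of order `2p^k`, `k ≥ 2` (Dodson's converse of
# Ribet's theorem beyond the cyclic case)

B. Dodson, *The structure of Galois groups of CM-fields*, Trans. AMS 283 (1984) [Dodson1984], §3.2.1 "THEOREM (A
Converse of Ribet's Theorem).  Let `n > 4` be composite and factor `n` as `n = kl`, with `k ≥ 3`, `l ≥ 2`.  Then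
there exist simple degenerate Abelian varieties of dimension `n` and rank `n − l + 2`.  *Proof.* … there exist
CM-fields `K` with `K/ℚ` Abelian and `Gal(K/ℚ) = ⟨ρ⟩ × ℤₙ = G` … consider the type defined by
`f = ((1, …, 1), 0_l, …, 0_l)`, written in `k` blocks, each with `l` entries … Finally, note that `Φ` is primitive
since the orbit of `f` under `G` has order `2n`" (held text `paper:doi-10-2307-1999987`, p. 13; tree:
`Dodson1984.exists_primitive_degenerate_blockType`, CYCLIC `G`).  B. Dodson [Dodson1987] Remark 1.1: "`B(n) < n + 1`
whenever `n` is composite".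

THIS FILE does it for EVERY finite abelian group `G` of order `2p^k` (`p` an odd prime, `k ≥ 2`) and every
involution `ρ ∈ G` — i.e. for the Galois group of every ABELIAN CM field of degree `2p^k`, cyclic or not — using
the character-free form of Kubota's Lemma 2 of the companion `DegenerateCMTypesAbelianPrimePowerKernels`
(`typeRank_add_sum_totient_eq`: `rank(S) = p^k + 1 − Σ_H φ([G:H])` over the subgroups `H ∌ ρ` with `G/H`
cyclic, `p ∣ [G:H]`, at which `S` is equidistributed):

* **`exists_primitive_equidistributed`** — for every subgroup `H ∌ ρ` of index `2p` (so `G/H ≅ ℤ/2p`, and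
  `P = {g : gH ∈ ⟨xH⟩}` is the subgroup of index `2`), with `x ∈ P ∖ H` and `h ∈ H ∖ {1, x^{−p}}`
  (`#H = p^{k−1} ≥ 3`): `T = {1, x, …, x^{p−2}, x^{p−1}h}` has one point in each coset of `H` in `P`, and the CM
  type `S = T ∪ ρ(P ∖ T)` is stable under NO `u ≠ 1` (primitive) and EQUIDISTRIBUTED AT `H`
  (`#(S ∩ gx'H) = #(S ∩ gH)` for all `g` and all `x'` with `x'^p ∈ H`): Dodson's `f = ((1,…,1),0,…,0)` with one
  point moved inside its coset to kill the stabiliser;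
* **`exists_primitive_typeRank_le_of_index_eq`** — hence `rank(S) ≤ p^k + 2 − p` (the `φ(2p) = p − 1` odd
  characters with kernel `H` vanish on `S`);
* **`exists_primitive_degenerate`** — on every abelian `G` of order `2p^k`, `k ≥ 2`, for every involution `ρ`,
  there is a primitive CM type of rank `≤ p^k + 2 − p`, in particular DEGENERATE (a subgroup of order `p^{k−1}`
  exists by Sylow and does not contain `ρ`).

Primitivity is Hazama's form "not stable under any `g ≠ 1`" (`CyclicCMType.IsStableUnder`; Shimura §8.2 Prop. 26
on an abelian field).  The number-field dress (every abelian CM field of degree `2p^k`, `k ≥ 2`, is the CM field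
of a SIMPLE degenerate abelian variety with an exceptional Hodge class) is the `Pohlmann1968/` companion.
THEOREMS ONLY: no definition, no named fact, no `sorry`.  The cyclic case with ALL ranks realised is
`DegenerateCMTypesCyclicPrimePowerExistence`; `⟨ρ⟩ × (ℤ/p)²` with the exact rank `(p−1)p + 2` is
`DegenerateCMTypesElementaryAbelianPrimeSquareCount`.

## References

* [Dodson1984] B. Dodson, Trans. AMS 283 (1984), §3.1.1, §3.2.1 Theorem (pp. 11–13).
* [Dodson1987] B. Dodson, J. Algebra 111 (1987), Remark 1.1, §4.1.
* [Kubota1965] T. Kubota, Trans. AMS 118 (1965), §4 Lemma 2.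
* [Hazama2003CyclicCM] F. Hazama, J. Math. Sci. Univ. Tokyo 10 (2003), Prop. 2.3 (primitive = no stabiliser).
* [Shimura1998] G. Shimura, *Abelian Varieties with Complex Multiplication and Modular Functions*, §8.2 Prop. 26.

## Provenance

Lane `lit-hodgefound` (Track 2, Layer A3 — CM types), seat `lit-hodgefound-p10` generation 36, row g36-#2;
neighbours cited by name, nothing restated: `DegenerateCMTypesAbelianPrimePowerKernels` (`typeRank_add_sum_totient_eq`),
`DegenerateCMTypesCyclicTwoOddPrimes` (`IsStableUnder`, `rho_mul_mem_iff`), `CMTypeRank` (`IsCMTypeWith`, `typeRank`).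
-/

open scoped BigOperators Classical

namespace Literature.NumberTheory.ComplexMultiplication

namespace CyclicCMType

namespace AbelianPrimePow

variable {G : Type*} [CommGroup G] [Fintype G] [DecidableEq G] {p : ℕ} [hp : Fact p.Prime] {ρ : G} {Φ : Finset G}

omit [Fintype G] [DecidableEq G] hp in
/-- From `IsCMTypeWith ρ S`: `ρ² = 1`. [folklore] -/
private theorem rho_mul_rho (h : IsCMTypeWith ρ (Φ : Set G)) : ρ * ρ = 1 := by
  have := h.invol 1
  simpa [smul_eq_mul] using this

/-! ## The construction -/

section Primitive

omit hp in
/-- A CM type on `G` has `|G|/2` elements. [folklore] -/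
private theorem two_mul_card_eq (h : IsCMTypeWith ρ (Φ : Set G)) : 2 * Φ.card = Fintype.card G := by
  have hρ2 := rho_mul_rho h
  have hρinv : ∀ g : G, ρ * (ρ * g) = g := fun g => by rw [← mul_assoc, hρ2, one_mul]
  have hdisj : Disjoint Φ (Φ.image fun g => ρ * g) := by
    rw [Finset.disjoint_left]
    intro s hs hs'
    obtain ⟨t, ht, rfl⟩ := Finset.mem_image.1 hs'
    exact ((rho_mul_mem_iff h t).1 hs) ht
  have hcover : Φ ∪ Φ.image (fun g => ρ * g) = Finset.univ := by
    ext g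
    simp only [Finset.mem_union, Finset.mem_univ, iff_true, Finset.mem_image]
    by_cases hg : g ∈ Φ
    · exact Or.inl hg
    · exact Or.inr ⟨ρ * g, (rho_mul_mem_iff h g).2 hg, hρinv g⟩
  have := congrArg Finset.card hcover
  rw [Finset.card_union_of_disjoint hdisj, Finset.card_image_of_injective _ (mul_right_injective ρ),
    Finset.card_univ] at this
  omega

omit [DecidableEq G] hp in
/-- The subgroup `H` as a finset has `|H|` elements. [folklore] -/
private theorem card_filter_mem_eq (H : Subgroup G) :
    (Finset.univ.filter fun g : G => g ∈ H).card = Nat.card H := by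
  have hset : ((Finset.univ.filter fun g : G => g ∈ H) : Set G) = (H : Set G) := by
    ext g; simp
  rw [← Set.ncard_coe_finset, hset]
  exact (Nat.card_coe_set_eq (H : Set G)).symm

omit hp in
/-- The coset `gH` as a finset has `|H|` elements. [folklore] -/
private theorem card_filter_inv_mul_mem (H : Subgroup G) (g : G) :
    (Finset.univ.filter fun s : G => g⁻¹ * s ∈ H).card = Nat.card H := by
  rw [← card_filter_mem_eq H]
  have : (Finset.univ.filter fun s : G => g⁻¹ * s ∈ H) =
      (Finset.univ.filter fun s : G => s ∈ H).image (g * ·) := by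
    ext s
    simp only [Finset.mem_filter, Finset.mem_univ, true_and, Finset.mem_image]
    constructor
    · intro hs; exact ⟨g⁻¹ * s, hs, mul_inv_cancel_left g s⟩
    · rintro ⟨t, ht, rfl⟩; rwa [inv_mul_cancel_left]
  rw [this, Finset.card_image_of_injective _ (mul_right_injective g)]

/-- **A PRIMITIVE CM TYPE EQUIDISTRIBUTED AT A GIVEN SUBGROUP OF INDEX `2p`** (any abelian group `G` of order
`2p^k`, `k ≥ 2`, `p` odd, `ρ ∈ G` an involution, `H ∌ ρ` a subgroup of index `2p`, so `G/H` is cyclic of order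
`2p` and `H♯ = P` is the subgroup of index `2`): with `x ∈ P ∖ H` and `h ∈ H ∖ {1, x^{−p}}`, the set
`T = {1, x, …, x^{p−2}, x^{p−1}h}` meets every coset of `H` in `P` exactly once, and
`S = T ∪ ρ(P ∖ T)` is a CM type, stable under no `u ≠ 1`, equidistributed at `H` — Dodson's type
`f = ((1,…,1), 0, …, 0)` of §3.2.1 ("consider the type defined by `f = ((1, …, 1), 0_l, …, 0_l)`, written in `k`
blocks … Finally, note that `Φ` is primitive since the orbit of `f` under `G` has order `2n`") transplanted from
the cyclic group `⟨ρ⟩ × ℤₙ` to an arbitrary abelian group of order `2p^k`, with one point moved inside its coset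
(`x^{p−1} ↦ x^{p−1}h`) to kill the stabiliser. [cite: Dodson1984, §3.2.1 Theorem (proof, p. 13)]
[cite: Kubota1965, §4 Lemma 2] -/
theorem exists_primitive_equidistributed (hp2 : p ≠ 2) {k : ℕ} (hk : 2 ≤ k) (hcard : Fintype.card G = 2 * p ^ k)
    (hρ2 : ρ * ρ = 1) (H : Subgroup G) (hρH : ρ ∉ H) (hidx : H.index = 2 * p) :
    ∃ Φ : Finset G, IsCMTypeWith ρ (Φ : Set G) ∧ (∀ u : G, u ≠ 1 → ¬ IsStableUnder Φ u) ∧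
      ∀ x : G, x ^ p ∈ H → ∀ g : G,
        (Φ.filter fun s => (g * x)⁻¹ * s ∈ H).card = (Φ.filter fun s => g⁻¹ * s ∈ H).card := by
  have hp3 : 3 ≤ p := by
    have := hp.out.two_le
    omega
  have hodd : Odd p := hp.out.odd_of_ne_two hp2
  -- the quotient `Q = G/H` of order `2p`, the involution `ρ̄` and an element `x̄` of order `p`
  have hQ : Nat.card (G ⧸ H) = 2 * p := by rw [← Subgroup.index_eq_card, hidx]
  have hρne : (ρ : G ⧸ H) ≠ 1 := fun h1 => hρH ((QuotientGroup.eq_one_iff ρ).1 h1)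
  have hρord : orderOf (ρ : G ⧸ H) = 2 := by
    haveI : Fact (Nat.Prime 2) := ⟨Nat.prime_two⟩
    refine orderOf_eq_prime ?_ hρne
    rw [← QuotientGroup.mk_pow, pow_two, hρ2, QuotientGroup.mk_one]
  obtain ⟨xq, hxq⟩ := exists_prime_orderOf_dvd_card' (G := G ⧸ H) p (by rw [hQ]; exact dvd_mul_left p 2)
  obtain ⟨x, rfl⟩ := QuotientGroup.mk_surjective xq
  have hxpH : x ^ p ∈ H := by
    rw [← QuotientGroup.eq_one_iff, QuotientGroup.mk_pow, ← hxq]; exact pow_orderOf_eq_one _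
  -- the subgroup `K = ⟨x̄⟩` of index `2` in `Q` and its preimage `P` of index `2` in `G`
  set K : Subgroup (G ⧸ H) := Subgroup.zpowers (x : G ⧸ H) with hK
  have hKcard : Nat.card K = p := by rw [hK, Nat.card_zpowers, hxq]
  have hKidx : K.index = 2 := by
    have := K.card_mul_index
    rw [hKcard, hQ] at this
    exact Nat.eq_of_mul_eq_mul_left hp.out.pos (by rw [this, mul_comm])
  have hρK : (ρ : G ⧸ H) ∉ K := fun hmem => by
    have h1 : orderOf (ρ : G ⧸ H) ∣ p := by
      rw [← hxq]; exact orderOf_dvd_of_mem_zpowers hmem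
    rw [hρord] at h1
    exact hp2 ((Nat.prime_dvd_prime_iff_eq Nat.prime_two hp.out).1 h1).symm
  set P : Subgroup G := K.comap (QuotientGroup.mk' H) with hP
  have hmemP : ∀ g : G, g ∈ P ↔ (g : G ⧸ H) ∈ K := fun g => Iff.rfl
  have hρmulP : ∀ g : G, ρ * g ∈ P ↔ g ∉ P := fun g => by
    rw [hmemP, hmemP, QuotientGroup.mk_mul, Subgroup.mul_mem_iff_of_index_two hKidx]
    constructor
    · intro h1 h2; exact hρK (h1.2 h2)
    · intro h1; exact ⟨fun h2 => absurd h2 hρK, fun h2 => absurd h2 h1⟩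
  have hHP : H ≤ P := fun g hg => by
    rw [hmemP, (QuotientGroup.eq_one_iff g).2 hg]; exact K.one_mem
  have hxP : x ∈ P := by rw [hmemP]; exact Subgroup.mem_zpowers _
  -- elements with `x'^p ∈ H` lie in `P`
  have hpowP : ∀ x' : G, x' ^ p ∈ H → x' ∈ P := fun x' hx' => by
    rw [hmemP]
    have hsq : (x' : G ⧸ H) * (x' : G ⧸ H) ∈ K :=
      (Subgroup.mul_mem_iff_of_index_two hKidx).2 Iff.rfl
    obtain ⟨m, hm⟩ := hodd
    have h1 : (x' : G ⧸ H) ^ p = 1 := by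
      rw [← QuotientGroup.mk_pow, QuotientGroup.eq_one_iff]; exact hx'
    have h2 : ((x' : G ⧸ H) ^ p) * (((x' : G ⧸ H) * (x' : G ⧸ H)) ^ m)⁻¹ = (x' : G ⧸ H) := by
      rw [← pow_two, ← pow_mul, hm, pow_succ, mul_comm (_ ^ _) (x' : G ⧸ H), mul_inv_cancel_right]
    rw [← h2, h1, one_mul]
    exact K.inv_mem (K.pow_mem hsq m)
  -- every element of `P` lies in `x^i H` for a unique `i < p`
  have hcoset : ∀ g : G, g ∈ P → ∃ i < p, (x ^ i)⁻¹ * g ∈ H := fun g hg => by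
    rw [hmemP, hK] at hg
    obtain ⟨n, hn⟩ := (Submonoid.mem_powers_iff _ _).1 ((mem_powers_iff_mem_zpowers).2 hg)
    refine ⟨n % p, Nat.mod_lt _ hp.out.pos, ?_⟩
    rw [← QuotientGroup.eq_one_iff, QuotientGroup.mk_mul, QuotientGroup.mk_inv, QuotientGroup.mk_pow,
      ← hxq, pow_mod_orderOf, hn, inv_mul_cancel]
  have huniq : ∀ (g : G) (i j : ℕ), i < p → j < p → (x ^ i)⁻¹ * g ∈ H → (x ^ j)⁻¹ * g ∈ H → i = j :=
    fun g i j hi hj h1 h2 => by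
    have h3 : (x ^ j)⁻¹ * x ^ i ∈ H := by
      have := H.mul_mem h2 (H.inv_mem h1)
      rwa [mul_inv_rev, inv_inv, mul_assoc, mul_inv_cancel_left] at this
    rw [← QuotientGroup.eq_one_iff, QuotientGroup.mk_mul, QuotientGroup.mk_inv, QuotientGroup.mk_pow,
      QuotientGroup.mk_pow, inv_mul_eq_one, pow_inj_mod, hxq, Nat.mod_eq_of_lt hj, Nat.mod_eq_of_lt hi] at h3
    exact h3.symm
  -- `|H| = p^{k−1} ≥ 3`: the moved point `h ∈ H`, `h ≠ 1`, `x^p h ≠ 1`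
  have hHcard : Nat.card H = p ^ (k - 1) := by
    have := H.card_mul_index
    rw [hidx, Nat.card_eq_fintype_card (α := G), hcard] at this
    have e : 2 * p ^ k = p ^ (k - 1) * (2 * p) := by
      have : p ^ k = p ^ (k - 1) * p := by rw [← pow_succ]; congr 1; omega
      rw [this]; ring
    exact mul_right_cancel₀ (by positivity) (this.trans e)
  obtain ⟨h, hhH, hh1, hhx⟩ : ∃ h : G, h ∈ H ∧ h ≠ 1 ∧ x ^ p * h ≠ 1 := by
    have h3 : 3 ≤ (Finset.univ.filter fun g : G => g ∈ H).card := by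
      rw [card_filter_mem_eq, hHcard]
      calc 3 ≤ p := hp3
        _ = p ^ 1 := (pow_one p).symm
        _ ≤ p ^ (k - 1) := Nat.pow_le_pow_right hp.out.pos (by omega)
    have h2 : ({1, (x ^ p)⁻¹} : Finset G).card ≤ 2 := Finset.card_le_two
    obtain ⟨h, hh, hh'⟩ := Finset.exists_mem_notMem_of_card_lt_card (s := ({1, (x ^ p)⁻¹} : Finset G))
      (t := Finset.univ.filter fun g : G => g ∈ H) (by omega)
    refine ⟨h, (Finset.mem_filter.1 hh).2, fun h1 => hh' (by rw [h1]; exact Finset.mem_insert_self _ _),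
      fun h1 => hh' ?_⟩
    rw [Finset.mem_insert, Finset.mem_singleton]
    exact Or.inr (eq_inv_of_mul_eq_one_right h1)
  -- the points `t i ∈ x^i H`
  set t : ℕ → G := fun i => if i < p - 1 then x ^ i else x ^ (p - 1) * h with ht
  have ht_lt : ∀ i, i < p - 1 → t i = x ^ i := fun i hi => by rw [ht]; exact if_pos hi
  have ht_top : t (p - 1) = x ^ (p - 1) * h := by rw [ht]; exact if_neg (lt_irrefl _)
  have htcoset : ∀ i, i < p → (x ^ i)⁻¹ * t i ∈ H := fun i hi => by
    by_cases hi' : i < p - 1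
    · rw [ht_lt i hi', inv_mul_cancel]; exact H.one_mem
    · have : i = p - 1 := by omega
      subst this
      rw [ht_top, inv_mul_cancel_left]; exact hhH
  have htP : ∀ i, i < p → t i ∈ P := fun i hi => by
    have : t i = x ^ i * ((x ^ i)⁻¹ * t i) := by rw [mul_inv_cancel_left]
    rw [this]
    exact P.mul_mem (P.pow_mem hxP i) (hHP (htcoset i hi))
  have htinj : ∀ i j, i < p → j < p → t i = t j → i = j := fun i j hi hj heq =>
    huniq (t i) i j hi hj (htcoset i hi) (heq ▸ htcoset j hj)
  set T : Finset G := (Finset.range p).image t with hT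
  have hmemT : ∀ s : G, s ∈ T ↔ ∃ i < p, t i = s := fun s => by
    simp only [hT, Finset.mem_image, Finset.mem_range]
  have hTcard : T.card = p := by
    rw [hT, Finset.card_image_of_injOn, Finset.card_range]
    intro i hi j hj heq
    exact htinj i j (Finset.mem_range.1 hi) (Finset.mem_range.1 hj) heq
  have hTP : ∀ s ∈ T, s ∈ P := fun s hs => by
    obtain ⟨i, hi, rfl⟩ := (hmemT s).1 hs
    exact htP i hi
  -- membership in a coset of `H` inside `P`
  have hgj : ∀ (g : G) (j : ℕ), (x ^ j)⁻¹ * g ∈ H → ∀ s : G, g⁻¹ * s ∈ H ↔ (x ^ j)⁻¹ * s ∈ H :=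
    fun g j hjg s => by
    have e : (x ^ j)⁻¹ * s = ((x ^ j)⁻¹ * g) * (g⁻¹ * s) := by rw [mul_assoc, mul_inv_cancel_left]
    constructor
    · intro hs; rw [e]; exact H.mul_mem hjg hs
    · intro hs
      have := H.mul_mem (H.inv_mem hjg) hs
      rwa [e, ← mul_assoc, inv_mul_cancel, one_mul] at this
  -- the unique point of `T` in the coset `gH`, `g ∈ P`
  have hTcoset : ∀ (g : G) (j : ℕ), j < p → (x ^ j)⁻¹ * g ∈ H →
      (T.filter fun s => g⁻¹ * s ∈ H) = {t j} := fun g j hj hjg => by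
    refine Finset.ext fun s => ?_
    rw [Finset.mem_filter, Finset.mem_singleton, hmemT, hgj g j hjg]
    constructor
    · rintro ⟨⟨i, hi, rfl⟩, hs⟩
      exact congrArg t (huniq (t i) i j hi hj (htcoset i hi) hs)
    · rintro rfl
      exact ⟨⟨j, hj, rfl⟩, htcoset j hj⟩
  have hTcosetcard : ∀ g : G, g ∈ P → (T.filter fun s => g⁻¹ * s ∈ H).card = 1 := fun g hg => by
    obtain ⟨j, hj, hjg⟩ := hcoset g hg
    rw [hTcoset g j hj hjg, Finset.card_singleton]
  -- THE TYPE `S = T ∪ ρ(P ∖ T)`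
  set Φ₀ : Finset G := T ∪ (Finset.univ.filter fun g : G => g ∈ P ∧ g ∉ T).image fun g => ρ * g with hΦ₀
  have hρinv : ∀ g : G, ρ * (ρ * g) = g := fun g => by rw [← mul_assoc, hρ2, one_mul]
  have hρinv' : ρ⁻¹ = ρ := inv_eq_of_mul_eq_one_right hρ2
  have hmemΦ : ∀ s : G, s ∈ Φ₀ ↔ (s ∈ P ∧ s ∈ T) ∨ (s ∉ P ∧ ρ * s ∉ T) := fun s => by
    simp only [hΦ₀, Finset.mem_union, Finset.mem_image, Finset.mem_filter, Finset.mem_univ, true_and]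
    constructor
    · rintro (hs | ⟨g, ⟨hgP, hgT⟩, rfl⟩)
      · exact Or.inl ⟨hTP s hs, hs⟩
      · refine Or.inr ⟨fun h1 => ((hρmulP g).1 h1) hgP, by rw [hρinv]; exact hgT⟩
    · rintro (⟨-, hs⟩ | ⟨hs1, hs2⟩)
      · exact Or.inl hs
      · exact Or.inr ⟨ρ * s, ⟨(hρmulP s).2 hs1, hs2⟩, hρinv s⟩
  have hmemΦP : ∀ s : G, s ∈ P → (s ∈ Φ₀ ↔ s ∈ T) := fun s hs => by
    rw [hmemΦ]; tauto
  have hmemΦnP : ∀ s : G, s ∉ P → (s ∈ Φ₀ ↔ ρ * s ∉ T) := fun s hs => by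
    rw [hmemΦ]; tauto
  have hcm : IsCMTypeWith ρ (Φ₀ : Set G) := by
    refine ⟨fun s => ?_, fun g s => ?_, fun s => ?_⟩
    · simp only [Finset.mem_coe, smul_eq_mul]
      by_cases hs : s ∈ P
      · have hρs : ρ * s ∉ P := fun h1 => ((hρmulP s).1 h1) hs
        rw [hmemΦP s hs, hmemΦnP _ hρs, hρinv, not_not]
      · have hρs : ρ * s ∈ P := (hρmulP s).2 hs
        rw [hmemΦnP s hs, hmemΦP _ hρs]
    · simp only [smul_eq_mul]; rw [mul_left_comm]
    · simp only [smul_eq_mul]; exact hρinv s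
  -- in a coset `gH ⊆ P` the type is `T ∩ gH`: one point
  have hcountP : ∀ g : G, g ∈ P → (Φ₀.filter fun s => g⁻¹ * s ∈ H).card = 1 := fun g hg => by
    rw [← hTcosetcard g hg]
    congr 1
    ext s
    simp only [Finset.mem_filter]
    constructor
    · rintro ⟨hs, hsH⟩
      have hsP : s ∈ P := by
        have : s = g * (g⁻¹ * s) := by rw [mul_inv_cancel_left]
        rw [this]; exact P.mul_mem hg (hHP hsH)
      exact ⟨(hmemΦP s hsP).1 hs, hsH⟩
    · rintro ⟨hs, hsH⟩
      exact ⟨(hmemΦP s (hTP s hs)).2 hs, hsH⟩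
  -- in a coset `gH ⊆ ρP` the type is `ρ((ρg)H ∖ T)`: `|H| − 1` points
  have hcountnP : ∀ g : G, g ∉ P → (Φ₀.filter fun s => g⁻¹ * s ∈ H).card = Nat.card H - 1 := fun g hg => by
    have hρg : ρ * g ∈ P := (hρmulP g).2 hg
    have hsP : ∀ s : G, g⁻¹ * s ∈ H → s ∉ P := fun s hsH hsP => by
      have : g = s * (g⁻¹ * s)⁻¹ := by rw [mul_inv_rev, inv_inv, mul_inv_cancel_left]
      exact hg (this ▸ P.mul_mem hsP (P.inv_mem (hHP hsH)))
    -- split the coset `gH` by `ρ s ∈ T`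
    have hsplit := Finset.card_filter_add_card_filter_not
      (s := Finset.univ.filter fun s : G => g⁻¹ * s ∈ H) (p := fun s : G => ρ * s ∈ T)
    rw [card_filter_inv_mul_mem, Finset.filter_filter, Finset.filter_filter] at hsplit
    have hone : (Finset.univ.filter fun s : G => g⁻¹ * s ∈ H ∧ ρ * s ∈ T).card = 1 := by
      have heq : (Finset.univ.filter fun s : G => g⁻¹ * s ∈ H ∧ ρ * s ∈ T) =
          (T.filter fun s => (ρ * g)⁻¹ * s ∈ H).image fun s => ρ * s := by
        ext s
        simp only [Finset.mem_filter, Finset.mem_univ, true_and, Finset.mem_image]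
        constructor
        · rintro ⟨hsH, hsT⟩
          refine ⟨ρ * s, ⟨hsT, ?_⟩, hρinv s⟩
          rwa [mul_inv_rev, mul_assoc, inv_mul_cancel_left]
        · rintro ⟨u, ⟨huT, huH⟩, rfl⟩
          refine ⟨?_, by rw [hρinv]; exact huT⟩
          rw [mul_inv_rev, hρinv', mul_assoc] at huH
          exact huH
      rw [heq, Finset.card_image_of_injective _ (mul_right_injective ρ), hTcosetcard _ hρg]
    have hmain : (Φ₀.filter fun s => g⁻¹ * s ∈ H) =
        Finset.univ.filter fun s : G => g⁻¹ * s ∈ H ∧ ¬ ρ * s ∈ T := by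
      ext s
      simp only [Finset.mem_filter, Finset.mem_univ, true_and]
      constructor
      · rintro ⟨hs, hsH⟩; exact ⟨hsH, (hmemΦnP s (hsP s hsH)).1 hs⟩
      · rintro ⟨hsH, hs⟩; exact ⟨(hmemΦnP s (hsP s hsH)).2 hs, hsH⟩
    rw [hmain]
    omega
  refine ⟨Φ₀, hcm, fun u hu1 hst => ?_, fun x' hx' g => ?_⟩
  · -- PRIMITIVITY: no `u ≠ 1` stabilises the type
    by_cases huP : u ∈ P
    · -- `u ∈ P` permutes `T`; read `u` in `x^a H`
      have huT : ∀ s ∈ T, u * s ∈ T := fun s hs =>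
        (hmemΦP _ (P.mul_mem huP (hTP s hs))).1 ((hst s).1 ((hmemΦP s (hTP s hs)).2 hs))
      -- the point of `T` in the coset of `u * t i` is `t` of the sum of indices
      have hut : ∀ (i : ℕ), i < p → ∀ (a : ℕ), a < p → (x ^ a)⁻¹ * u ∈ H →
          u * t i = t ((a + i) % p) := fun i hi a ha hau => by
        have hmem : u * t i ∈ T := huT _ ((hmemT _).2 ⟨i, hi, rfl⟩)
        obtain ⟨j, hj, hjeq⟩ := (hmemT _).1 hmem
        -- `u t i ∈ x^{a+i} H`
        have hcos : (x ^ ((a + i) % p))⁻¹ * (u * t i) ∈ H := by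
          have h1 : (x ^ (a + i))⁻¹ * (u * t i) = ((x ^ a)⁻¹ * u) * ((x ^ i)⁻¹ * t i) := by
            rw [pow_add, mul_inv_rev, mul_comm ((x ^ i)⁻¹) ((x ^ a)⁻¹), mul_mul_mul_comm]
          have h2 : (x ^ (a + i))⁻¹ * (u * t i) ∈ H := by rw [h1]; exact H.mul_mem hau (htcoset i hi)
          have h3 : (x ^ ((a + i) % p))⁻¹ * x ^ (a + i) ∈ H := by
            rw [← QuotientGroup.eq_one_iff, QuotientGroup.mk_mul, QuotientGroup.mk_inv, QuotientGroup.mk_pow,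
              QuotientGroup.mk_pow, ← hxq, pow_mod_orderOf, inv_mul_cancel]
          have := H.mul_mem h3 h2
          rwa [mul_assoc, mul_inv_cancel_left] at this
        rw [← hjeq]
        exact congrArg t (huniq (t j) j _ hj (Nat.mod_lt _ hp.out.pos) (htcoset j hj) (hjeq ▸ hcos))
      obtain ⟨a, ha, hau⟩ := hcoset u huP
      have hp1 : p - 1 < p := by omega
      by_cases ha0 : a = 0
      · -- `u ∈ H`: `u = u · t 0 = t 0 = 1`
        subst ha0
        have := hut 0 hp.out.pos 0 ha hau
        rw [Nat.zero_add, Nat.zero_mod, ht_lt 0 (by omega), pow_zero, mul_one] at this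
        exact hu1 this
      by_cases hap : a < p - 1
      · -- `u = x^a` and `u · t (p−1−a) = x^{p−1} = t (p−1) = x^{p−1} h`
        have hu : u = x ^ a := by
          have := hut 0 hp.out.pos a ha hau
          rwa [ht_lt 0 (by omega), pow_zero, mul_one, Nat.add_zero, Nat.mod_eq_of_lt ha, ht_lt a hap] at this
        have := hut (p - 1 - a) (by omega) a ha hau
        rw [hu, ht_lt (p - 1 - a) (by omega), ← pow_add, show a + (p - 1 - a) = p - 1 by omega,
          Nat.mod_eq_of_lt hp1, ht_top] at this
        exact hh1 (mul_left_cancel (a := x ^ (p - 1)) (by rw [mul_one]; exact this)).symm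
      · -- `a = p − 1`: `u = x^{p−1} h` and `u · t 1 = x^p h = t 0 = 1`
        have hap' : a = p - 1 := by omega
        subst hap'
        have hu : u = x ^ (p - 1) * h := by
          have := hut 0 hp.out.pos (p - 1) ha hau
          rwa [ht_lt 0 (by omega), pow_zero, mul_one, Nat.add_zero, Nat.mod_eq_of_lt ha, ht_top] at this
        have := hut 1 (by omega) (p - 1) ha hau
        rw [hu, ht_lt 1 (by omega), pow_one, show p - 1 + 1 = p by omega, Nat.mod_self, ht_lt 0 (by omega),
          pow_zero] at this
        apply hhx
        rw [← this, mul_right_comm, ← pow_succ, show p - 1 + 1 = p by omega]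
    · -- `u ∉ P` maps `S ∖ P` injectively into `S ∩ P = T`: `p^k − p ≤ p`, absurd
      have hmap : ∀ s ∈ Φ₀.filter (fun s => s ∉ P), u * s ∈ T := fun s hs => by
        rw [Finset.mem_filter] at hs
        have husP : u * s ∈ P := by
          rw [hmemP, QuotientGroup.mk_mul, Subgroup.mul_mem_iff_of_index_two hKidx]
          exact ⟨fun h1 => absurd h1 huP, fun h1 => absurd h1 hs.2⟩
        exact (hmemΦP _ husP).1 ((hst s).1 hs.1)
      have hle : (Φ₀.filter fun s => s ∉ P).card ≤ T.card :=
        Finset.card_le_card_of_injOn (fun s => u * s) hmap fun s _ s' _ h => mul_left_cancel h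
      have hsplit := Finset.card_filter_add_card_filter_not (s := Φ₀) (p := fun s : G => s ∈ P)
      have hin : (Φ₀.filter fun s => s ∈ P) = T := by
        ext s
        rw [Finset.mem_filter]
        constructor
        · rintro ⟨hs, hsP⟩; exact (hmemΦP s hsP).1 hs
        · intro hs; exact ⟨(hmemΦP s (hTP s hs)).2 hs, hTP s hs⟩
      rw [hin, hTcard] at hsplit
      have hΦcard : 2 * Φ₀.card = 2 * p ^ k := by rw [two_mul_card_eq hcm, hcard]
      rw [hTcard] at hle
      have hpk : p ^ 2 ≤ p ^ k := Nat.pow_le_pow_right hp.out.pos hk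
      nlinarith
  · -- EQUIDISTRIBUTION at `H`
    have hx'P : x' ∈ P := hpowP x' hx'
    by_cases hg : g ∈ P
    · rw [hcountP g hg, hcountP (g * x') (P.mul_mem hg hx'P)]
    · have hgx : g * x' ∉ P := fun h1 => hg (by
        have := P.mul_mem h1 (P.inv_mem hx'P)
        rwa [mul_inv_cancel_right] at this)
      rw [hcountnP g hg, hcountnP (g * x') hgx]

omit [Fintype G] [DecidableEq G] in
/-- An abelian group of order `2p` (`p` odd) containing an involution is cyclic. [folklore] -/
private theorem isCyclic_quotient_of_index_eq [Finite G] (hp2 : p ≠ 2) {H : Subgroup G} (hρH : ρ ∉ H)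
    (hρ2 : ρ * ρ = 1) (hidx : H.index = 2 * p) : IsCyclic (G ⧸ H) := by
  have hcop : Nat.Coprime 2 p := Nat.coprime_two_left.2 (hp.out.odd_of_ne_two hp2)
  have hρne : (ρ : G ⧸ H) ≠ 1 := fun h1 => hρH ((QuotientGroup.eq_one_iff ρ).1 h1)
  have hρord : orderOf (ρ : G ⧸ H) = 2 := by
    haveI : Fact (Nat.Prime 2) := ⟨Nat.prime_two⟩
    refine orderOf_eq_prime ?_ hρne
    rw [← QuotientGroup.mk_pow, pow_two, hρ2, QuotientGroup.mk_one]
  rw [Subgroup.index_eq_card] at hidx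
  obtain ⟨b, hb⟩ := exists_prime_orderOf_dvd_card' (G := G ⧸ H) p (by rw [hidx]; exact dvd_mul_left p 2)
  have hcomm : Commute (ρ : G ⧸ H) b := Commute.all _ _
  have hcop' : (orderOf (ρ : G ⧸ H)).Coprime (orderOf b) := by rw [hρord, hb]; exact hcop
  have hord : orderOf ((ρ : G ⧸ H) * b) = Nat.card (G ⧸ H) := by
    rw [hcomm.orderOf_mul_eq_mul_orderOf_of_coprime hcop', hρord, hb, hidx]
  exact isCyclic_of_orderOf_eq_card _ hord

/-- **For every subgroup `H ∌ ρ` of index `2p` there is a PRIMITIVE CM type of rank `≤ p^k + 2 − p`,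
equidistributed at `H`** (abelian `G` of order `2p^k`, `k ≥ 2`, `p` odd): the `φ(2p) = p − 1` odd characters
with kernel `H` all vanish on it (Kubota), so it is DEGENERATE — Dodson's converse of Ribet's theorem
(§3.2.1: "there exist simple degenerate Abelian varieties of dimension `n` and rank `n − l + 2`" on the cyclic
group `⟨ρ⟩ × ℤₙ`) on an ARBITRARY abelian group of order `2p^k`. [cite: Dodson1984, §3.2.1 Theorem (p. 13)]
[cite: Kubota1965, §4 Lemma 2] -/
theorem exists_primitive_typeRank_le_of_index_eq (hp2 : p ≠ 2) {k : ℕ} (hk : 2 ≤ k)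
    (hcard : Fintype.card G = 2 * p ^ k) (hρ2 : ρ * ρ = 1) (H : Subgroup G) (hρH : ρ ∉ H)
    (hidx : H.index = 2 * p) :
    ∃ Φ : Finset G, IsCMTypeWith ρ (Φ : Set G) ∧ (∀ u : G, u ≠ 1 → ¬ IsStableUnder Φ u) ∧
      (∀ x : G, x ^ p ∈ H → ∀ g : G,
        (Φ.filter fun s => (g * x)⁻¹ * s ∈ H).card = (Φ.filter fun s => g⁻¹ * s ∈ H).card) ∧
      typeRank G (Φ : Set G) + (p - 1) ≤ p ^ k + 1 := by
  obtain ⟨Φ₀, hcm, hprim, hEQ⟩ := exists_primitive_equidistributed hp2 hk hcard hρ2 H hρH hidx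
  refine ⟨Φ₀, hcm, hprim, hEQ, ?_⟩
  have key := typeRank_add_sum_totient_eq hp2 hcard hcm
  have hcyc : IsCyclic (G ⧸ H) := isCyclic_quotient_of_index_eq hp2 hρH hρ2 hidx
  have hmem : H ∈ (Finset.univ : Finset (Subgroup G)).filter (fun H => ρ ∉ H ∧ IsCyclic (G ⧸ H) ∧
      p ∣ H.index ∧ ∀ x : G, x ^ p ∈ H → ∀ g : G,
        (Φ₀.filter fun s => (g * x)⁻¹ * s ∈ H).card = (Φ₀.filter fun s => g⁻¹ * s ∈ H).card) :=
    Finset.mem_filter.2 ⟨Finset.mem_univ _, hρH, hcyc, by rw [hidx]; exact dvd_mul_left p 2, hEQ⟩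
  have hle := Finset.single_le_sum (fun H' _ => Nat.zero_le (Subgroup.index H').totient) hmem
  have htot : H.index.totient = p - 1 := by
    rw [hidx, Nat.totient_mul (Nat.coprime_two_left.2 (hp.out.odd_of_ne_two hp2)), Nat.totient_two,
      Nat.totient_prime hp.out, one_mul]
  rw [htot] at hle
  omega

/-- **PRIMITIVE DEGENERATE CM TYPES EXIST ON EVERY ABELIAN GROUP OF ORDER `2p^k`, `k ≥ 2`** (`p` an odd
prime, `ρ` any involution of `G`): a CM type for `ρ`, stable under no `u ≠ 1` (primitive: its realisations on
an abelian CM field with group `G` are SIMPLE abelian varieties), of Kubota rank `≤ p^k + 2 − p < p^k + 1`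
(degenerate) — Dodson: "there exist simple degenerate Abelian varieties of dimension `n` and rank `n − l + 2`"
for `n = kl` composite, constructed on `⟨ρ⟩ × ℤₙ`; here on every abelian group `⟨ρ⟩ × P`, `|P| = p^k`
(cyclic: `DegenerateCMTypesCyclicPrimePowerExistence`; `(ℤ/p)²`: `DegenerateCMTypesElementaryAbelianPrimeSquareCount`).
[cite: Dodson1984, §3.2.1 Theorem (p. 13)] [cite: Dodson1987, Remark 1.1] [cite: Kubota1965, §4 Lemma 2] -/
theorem exists_primitive_degenerate (hp2 : p ≠ 2) {k : ℕ} (hk : 2 ≤ k) (hcard : Fintype.card G = 2 * p ^ k)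
    (hρ1 : ρ ≠ 1) (hρ2 : ρ * ρ = 1) :
    ∃ Φ : Finset G, IsCMTypeWith ρ (Φ : Set G) ∧ (∀ u : G, u ≠ 1 → ¬ IsStableUnder Φ u) ∧
      typeRank G (Φ : Set G) + (p - 1) ≤ p ^ k + 1 ∧ typeRank G (Φ : Set G) ≠ p ^ k + 1 := by
  -- a subgroup of order `p^{k−1}`: index `2p`, not containing the involution
  have hdvd : p ^ (k - 1) ∣ Nat.card G := by
    rw [Nat.card_eq_fintype_card, hcard]
    exact Dvd.dvd.mul_left (pow_dvd_pow p (Nat.sub_le k 1)) 2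
  obtain ⟨H, hH⟩ := Sylow.exists_subgroup_card_pow_prime p hdvd
  have hidx : H.index = 2 * p := by
    have := H.card_mul_index
    rw [hH, Nat.card_eq_fintype_card (α := G), hcard] at this
    have e : 2 * p ^ k = p ^ (k - 1) * (2 * p) := by
      have : p ^ k = p ^ (k - 1) * p := by rw [← pow_succ]; congr 1; omega
      rw [this]; ring
    exact mul_left_cancel₀ (pow_ne_zero _ hp.out.ne_zero) (this.trans e)
  have hρH : ρ ∉ H := fun hρH => by
    have h1 : orderOf ρ ∣ Nat.card H := Subgroup.orderOf_dvd_natCard H hρH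
    haveI : Fact (Nat.Prime 2) := ⟨Nat.prime_two⟩
    rw [orderOf_eq_prime (by rw [pow_two, hρ2]) hρ1, hH] at h1
    have := (Nat.prime_dvd_prime_iff_eq Nat.prime_two hp.out).1 (Nat.prime_two.dvd_of_dvd_pow h1)
    exact hp2 this.symm
  obtain ⟨Φ₀, hcm, hprim, -, hle⟩ := exists_primitive_typeRank_le_of_index_eq hp2 hk hcard hρ2 H hρH hidx
  have hp3 : 3 ≤ p := by have := hp.out.two_le; omega
  exact ⟨Φ₀, hcm, hprim, hle, by omega⟩

end Primitive

end AbelianPrimePow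

end CyclicCMType

end Literature.NumberTheory.ComplexMultiplication
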